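import Summits.ValiantsHypothesis.ValiantsHypothesis.Theorems.KPlusLogSqLawTropicalBLexCoreLaws
import Summits.ValiantsHypothesis.ValiantsHypothesis.Theorems.KPlusLogSqLawTropicalBLexCoreHall

/-!
# Route «KPlusLogSqLaw», crux `TropicalB` (stmt-ValiantsHypothesis-19771) — LEX-NT, part 8: the SHIFT CLOSURE
# (shifted lex cores `T_t = (3^t 2^{m−t}, 3^{t+1} 1^{m−1−t}, 3^{t+1} 2 0^{m−2−t})`: ANY transversal with at most `t` top cells closes the Latin triple)

HONEST FRAMING.  Structure lemma for dominance designs of any format (seat val-sym-trop-p5 g14, 2026-08-28; cell `pub-symmetroid`,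
`--supports stmt-ValiantsHypothesis-19771 --as helper`).  It REDUCES the infeasibility of every shifted lex core `T_t` to a purely combinatorial
existence statement (a slot transversal other than the first term with at most `t` cells of the top class); it proves no core law by itself for
`t ≥ 1` (for `t = 0` the transversal is the switched matching of the descent lemma, `…TropicalBLexCoreLaw`).  Nothing here bears on `TropicalB` in its
window, `WeakLifting`, DoorA26 / DoorA34, `MatrixDescartes` (stmt-ValiantsHypothesis-18050) or VP ≠ VNP.

CONTENT.
* `latin_contra_sum` — `latin_contra` (part 3a) with the first prefix condition in AGGREGATE form (`S(Q₀) ≤ S(T 0)` instead of column-wise domination)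
  and «`Q₀ ≠ T 0` in row OR class».
* counting lemmas: `sum_three_card_filter` (over three slot transversals the class counts add up to the column totals), `le_sum_of_card_filter`
  (a term with `≥ n₃` top cells and `≥ n₂` cells of class `c₂` has `S ≥ n₃ d c₃ + n₂ d c₂ + (m − n₃ − n₂) d c₀`), `sum_le_of_card_filter`.
* `shift_closure` — **SHIFT CLOSURE.**  Classes `d c₀ < d c₁ < d c₂ < d c₃`; dominant `A ≺ B ≺ C` with `A` = `t` cells of class `c₃` and `m − t` of
  class `c₂`, `B` = `t + 1` cells `c₃`, the rest `c₁`, `C` = `t + 1` cells `c₃`, one cell `c₂`, the rest `c₀` (`m ≥ t + 2`).  Then NO slot transversal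
  `M` (injective row map through the cells of `A, B, C`) other than `A`'s term has at most `t` cells of class `c₃`.  Proof: Kőnig/Hall (`two_factor`)
  splits the remaining cells into two transversals; the `3t + 2 − n₃(M) ≥ 2t + 2` remaining top cells give one of them `≥ t + 2` top cells, or both
  exactly `t + 1` — and then the `m − t + 1` cells of class `c₂` are not all inside `M` (it has at most `m − t` non-top cells), so one of the two also
  carries a `c₂` cell; either way its total exponent is `≥ S(C)`, while `S(M) ≤ t·d c₃ + (m − t)·d c₂ = S(A)`: `latin_contra_sum`.
LOCATED USE (this seat, exp/t1_explore.py): for `t = 1` the transversal EXISTS in every pairwise-law-consistent configuration at `m = 5` (2 853 of them up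
to symmetry) and `m = 6` (15 889) — so `T_1` is infeasible there and the lex `(5,4)`, `(6,4)` cells miss ≥ 2 histograms; at `m = 4` it fails in 12 of 216
configurations and `T_1` is realisable (corecert).  The all-`m` existence statement for `t = 1`, `m ≥ 5` is OPEN (memo LEX-NT-g14 §4).  [this cell]
-/

set_option linter.dupNamespace false
set_option autoImplicit false

namespace Summit.ValiantsHypothesis.ValiantsHypothesis.Theorems.KPlusLogSqLaw

namespace LexCore

open Summit.ValiantsHypothesis.ValiantsHypothesis.Theorems.MatrixDescartes.Negative
open Finset

variable {m K : ℕ}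

/-! ## 1. The Latin closure with an aggregate first prefix -/

/-- `latin_contra` with the first prefix condition in aggregate form and «differs in row or class». [this cell] -/
theorem latin_contra_sum (d : Fin K → ℕ) (v ε : Fin m → Fin m → Fin K → ℤ) (T : Fin 3 → Equiv.Perm (Fin m) × (Fin m → Fin K))
    (θ3 : Fin 3 → ℤ) (h01 : θ3 0 < θ3 1) (h12 : θ3 1 < θ3 2) (hdom : ∀ k, IsDominant d v ε (θ3 k) (T k))
    (s₀ s₁ s₂ : Fin m → Fin 3) (hd01 : ∀ b, s₀ b ≠ s₁ b) (hd02 : ∀ b, s₀ b ≠ s₂ b) (hd12 : ∀ b, s₁ b ≠ s₂ b)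
    (hi₀ : Function.Injective fun b => (T (s₀ b)).1 b) (hi₁ : Function.Injective fun b => (T (s₁ b)).1 b)
    (hi₂ : Function.Injective fun b => (T (s₂ b)).1 b)
    (hne : ∃ b, (T (s₀ b)).1 b ≠ (T 0).1 b ∨ (T (s₀ b)).2 b ≠ (T 0).2 b)
    (hP1 : ∑ b, (d ((T (s₀ b)).2 b) : ℤ) ≤ ∑ b, (d ((T 0).2 b) : ℤ))
    (hP2 : ∑ b, (d ((T 2).2 b) : ℤ) ≤ ∑ b, (d ((T (s₂ b)).2 b) : ℤ)) : False := by
  classical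
  -- the three transversal terms
  set Q₀ : Equiv.Perm (Fin m) × (Fin m → Fin K) :=
    (Equiv.ofBijective _ (Finite.injective_iff_bijective.mp hi₀), fun b => (T (s₀ b)).2 b) with hQ₀
  set Q₁ : Equiv.Perm (Fin m) × (Fin m → Fin K) :=
    (Equiv.ofBijective _ (Finite.injective_iff_bijective.mp hi₁), fun b => (T (s₁ b)).2 b) with hQ₁
  set Q₂ : Equiv.Perm (Fin m) × (Fin m → Fin K) :=
    (Equiv.ofBijective _ (Finite.injective_iff_bijective.mp hi₂), fun b => (T (s₂ b)).2 b) with hQ₂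
  have hQ₀1 : ∀ b, Q₀.1 b = (T (s₀ b)).1 b := fun b => by rw [hQ₀, Equiv.ofBijective_apply]
  have hQ₁1 : ∀ b, Q₁.1 b = (T (s₁ b)).1 b := fun b => by rw [hQ₁, Equiv.ofBijective_apply]
  have hQ₂1 : ∀ b, Q₂.1 b = (T (s₂ b)).1 b := fun b => by rw [hQ₂, Equiv.ofBijective_apply]
  have hQ₀2 : ∀ b, Q₀.2 b = (T (s₀ b)).2 b := fun b => rfl
  have hQ₁2 : ∀ b, Q₁.2 b = (T (s₁ b)).2 b := fun b => rfl
  have hQ₂2 : ∀ b, Q₂.2 b = (T (s₂ b)).2 b := fun b => rfl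
  -- ℕ-indexed families
  set P : ℕ → Equiv.Perm (Fin m) × (Fin m → Fin K) := fun j => if j = 0 then T 0 else if j = 1 then T 1 else T 2 with hP
  set Q : ℕ → Equiv.Perm (Fin m) × (Fin m → Fin K) := fun j => if j = 0 then Q₀ else if j = 1 then Q₁ else Q₂ with hQ
  set θ : ℕ → ℤ := fun j => if j = 0 then θ3 0 else if j = 1 then θ3 1 else θ3 2 with hθ
  have P0 : P 0 = T 0 := by simp [hP]
  have P1 : P 1 = T 1 := by simp [hP]
  have P2 : P 2 = T 2 := by simp [hP]
  have Q0 : Q 0 = Q₀ := by simp [hQ]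
  have Q1 : Q 1 = Q₁ := by simp [hQ]
  have Q2 : Q 2 = Q₂ := by simp [hQ]
  -- hypotheses of the multi-exchange law
  have hθ' : ∀ i, i + 1 < 3 → θ i ≤ θ (i + 1) := by
    intro i hi
    have : i = 0 ∨ i = 1 := by omega
    rcases this with rfl | rfl
    · simp [hθ]; exact h01.le
    · simp [hθ]; exact h12.le
  have hdom' : ∀ j, j < 3 → IsDominant d v ε (θ j) (P j) := by
    intro j hj
    have : j = 0 ∨ j = 1 ∨ j = 2 := by omega
    rcases this with rfl | rfl | rfl
    · simp [hθ, hP]; exact hdom 0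
    · simp [hθ, hP]; exact hdom 1
    · simp [hθ, hP]; exact hdom 2
  -- presence of the transversal terms
  have pres : ∀ (s : Fin m → Fin 3) (q : Equiv.Perm (Fin m) × (Fin m → Fin K)),
      (∀ b, q.1 b = (T (s b)).1 b) → (∀ b, q.2 b = (T (s b)).2 b) → termSign ε q ≠ 0 := by
    intro s q h1 h2
    have e : q = (q.1, q.2) := rfl
    rw [e]
    unfold termSign
    refine mul_ne_zero (Units.ne_zero _) (Finset.prod_ne_zero_iff.mpr fun b _ => ?_)
    simp only
    rw [h1 b, h2 b]
    exact LacunarySymmetroidMatrixDescartes.TropicalCensus.present_of_termSign_ne_zero ε (T (s b)) (hdom (s b)).1 b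
  have hQpres : ∀ j, j < 3 → termSign ε (Q j) ≠ 0 := by
    intro j hj
    have : j = 0 ∨ j = 1 ∨ j = 2 := by omega
    rcases this with rfl | rfl | rfl
    · rw [Q0]; exact pres s₀ Q₀ hQ₀1 hQ₀2
    · rw [Q1]; exact pres s₁ Q₁ hQ₁1 hQ₁2
    · rw [Q2]; exact pres s₂ Q₂ hQ₂1 hQ₂2
  -- `Q₀ ≠ T 0`
  have hne' : ∃ j, j < 3 ∧ Q j ≠ P j := by
    obtain ⟨b, hb⟩ := hne
    refine ⟨0, by omega, fun h => ?_⟩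
    rw [Q0, P0] at h
    rcases hb with hb | hb
    · exact hb (by rw [← hQ₀1 b, h])
    · exact hb (by rw [← hQ₀2 b, h])
  -- incidence counts agree column by column
  have hinc : ∀ (b : Fin m) (al : Fin m × Fin K),
      ((range 3).filter fun j => ((P j).1 b, (P j).2 b) = al).card =
        ((range 3).filter fun j => ((Q j).1 b, (Q j).2 b) = al).card := by
    intro b al
    rw [card_filter_range_three (fun j => ((P j).1 b, (P j).2 b)) al, card_filter_range_three (fun j => ((Q j).1 b, (Q j).2 b)) al]
    simp only [P0, P1, P2, Q0, Q1, Q2, hQ₀1, hQ₁1, hQ₂1, hQ₀2, hQ₁2, hQ₂2]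
    have key := perm3_sum (fun s => if (((T s).1 b, (T s).2 b) : Fin m × Fin K) = al then 1 else 0) (s₀ b) (s₁ b) (s₂ b)
      (hd01 b) (hd02 b) (hd12 b)
    omega
  -- the multi-exchange law
  obtain ⟨j, hj, hlt⟩ := MultiExchange.prefix_deficit d v ε 3 θ P Q hθ' hdom' hQpres hne' hinc
  have hS := MultiExchange.sum_sum_eq_of_count_eq 3 P Q hinc fun _ al => (d al.2 : ℤ)
  simp only [Finset.sum_range_succ, Finset.sum_range_zero, zero_add, P0, P1, P2, Q0, Q1, Q2] at hS
  have hj' : j = 0 ∨ j = 1 := by omega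
  rcases hj' with rfl | rfl
  · -- prefix of length one: `S(T 0) < S(Q₀)`, against the column-wise domination
    simp only [zero_add, Finset.sum_range_one, P0, Q0] at hlt
    have hge : ∑ b, (d (Q₀.2 b) : ℤ) ≤ ∑ b, (d ((T 0).2 b) : ℤ) := by
      have e : ∑ b, (d (Q₀.2 b) : ℤ) = ∑ b, (d ((T (s₀ b)).2 b) : ℤ) := Finset.sum_congr rfl fun b _ => by rw [hQ₀2 b]
      rw [e]; exact hP1
    exact absurd hlt (not_lt.mpr hge)
  · -- prefix of length two: `S(Q₂) < S(T 2)`, against `hP2`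
    simp only [Finset.sum_range_succ, Finset.sum_range_zero, zero_add, P0, P1, Q0, Q1] at hlt
    have hQ2sum : ∑ b, (d (Q₂.2 b) : ℤ) = ∑ b, (d ((T (s₂ b)).2 b) : ℤ) := Finset.sum_congr rfl fun b _ => by rw [hQ₂2 b]
    linarith


/-! ## 2. Counting over three slot transversals -/

/-- over three pointwise distinct slot choices the per-class counts add up to the per-column totals. [folklore] -/
theorem sum_three_card_filter (cls : Fin 3 → Fin m → Fin K) (s₀ s₁ s₂ : Fin m → Fin 3)
    (hd01 : ∀ b, s₀ b ≠ s₁ b) (hd02 : ∀ b, s₀ b ≠ s₂ b) (hd12 : ∀ b, s₁ b ≠ s₂ b) (c : Fin K) :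
    (univ.filter fun b => cls (s₀ b) b = c).card + (univ.filter fun b => cls (s₁ b) b = c).card +
        (univ.filter fun b => cls (s₂ b) b = c).card =
      (univ.filter fun b => cls 0 b = c).card + (univ.filter fun b => cls 1 b = c).card + (univ.filter fun b => cls 2 b = c).card := by
  classical
  simp only [Finset.card_filter]
  rw [← Finset.sum_add_distrib, ← Finset.sum_add_distrib, ← Finset.sum_add_distrib, ← Finset.sum_add_distrib]
  refine Finset.sum_congr rfl fun b _ => ?_
  exact perm3_sum (fun s => if cls s b = c then 1 else 0) (s₀ b) (s₁ b) (s₂ b) (hd01 b) (hd02 b) (hd12 b)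

/-- a class function with `≥ n₃` cells of class `c₃`, `≥ n₂` cells of class `c₂` (`c₂ ≠ c₃`) and all classes of exponent `≥ d c₀` has total exponent
`≥ n₃ d c₃ + n₂ d c₂ + (m − n₃ − n₂) d c₀`. [folklore] -/
theorem le_sum_of_card_filter (d : Fin K → ℕ) (q : Fin m → Fin K) (c₀ c₂ c₃ : Fin K) (h02 : d c₀ ≤ d c₂) (h03 : d c₀ ≤ d c₃) (hc : c₂ ≠ c₃)
    (hlow : ∀ b, d c₀ ≤ d (q b)) (n₃ n₂ : ℕ) (hn₃ : n₃ ≤ (univ.filter fun b => q b = c₃).card)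
    (hn₂ : n₂ ≤ (univ.filter fun b => q b = c₂).card) :
    (n₃ : ℤ) * d c₃ + (n₂ : ℤ) * d c₂ + ((m : ℤ) - n₃ - n₂) * d c₀ ≤ ∑ b, (d (q b) : ℤ) := by
  classical
  -- pointwise: `d (q b) ≥ d c₀ + [q b = c₃](d c₃ − d c₀) + [q b = c₂](d c₂ − d c₀)`
  have hpt : ∀ b, (d c₀ : ℤ) + ((if q b = c₃ then ((d c₃ : ℤ) - d c₀) else 0) + (if q b = c₂ then ((d c₂ : ℤ) - d c₀) else 0)) ≤ d (q b) := by
    intro b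
    by_cases h3 : q b = c₃
    · rw [if_pos h3, if_neg (by rw [h3]; exact fun h => hc h.symm), h3]; ring_nf; exact le_refl _
    · rw [if_neg h3]
      by_cases h2 : q b = c₂
      · rw [if_pos h2, h2]; ring_nf; exact le_refl _
      · rw [if_neg h2]; simp only [add_zero]; exact_mod_cast hlow b
  have hsum := Finset.sum_le_sum fun b (_ : b ∈ (univ : Finset (Fin m))) => hpt b
  rw [Finset.sum_add_distrib, Finset.sum_add_distrib, Finset.sum_const, Finset.card_univ, Fintype.card_fin, nsmul_eq_mul] at hsum
  rw [Finset.sum_ite, Finset.sum_const_zero, add_zero, Finset.sum_const, nsmul_eq_mul] at hsum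
  rw [Finset.sum_ite, Finset.sum_const_zero, add_zero, Finset.sum_const, nsmul_eq_mul] at hsum
  have e3 : (0 : ℤ) ≤ (d c₃ : ℤ) - d c₀ := by have := h03; omega
  have e2 : (0 : ℤ) ≤ (d c₂ : ℤ) - d c₀ := by have := h02; omega
  have k3 : (n₃ : ℤ) * ((d c₃ : ℤ) - d c₀) ≤ ((univ.filter fun b => q b = c₃).card : ℤ) * ((d c₃ : ℤ) - d c₀) :=
    mul_le_mul_of_nonneg_right (by exact_mod_cast hn₃) e3
  have k2 : (n₂ : ℤ) * ((d c₂ : ℤ) - d c₀) ≤ ((univ.filter fun b => q b = c₂).card : ℤ) * ((d c₂ : ℤ) - d c₀) :=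
    mul_le_mul_of_nonneg_right (by exact_mod_cast hn₂) e2
  linarith

/-- a class function all of whose classes are `c₃` or of exponent `≤ d c₂` (`d c₂ ≤ d c₃`), with at most `s` cells of class `c₃`, has total exponent
`≤ s d c₃ + (m − s) d c₂`. [folklore] -/
theorem sum_le_of_card_filter (d : Fin K → ℕ) (q : Fin m → Fin K) (c₂ c₃ : Fin K) (h23 : d c₂ ≤ d c₃)
    (hcls : ∀ b, q b = c₃ ∨ d (q b) ≤ d c₂) (s : ℕ) (hs : (univ.filter fun b => q b = c₃).card ≤ s) :
    ∑ b, (d (q b) : ℤ) ≤ (s : ℤ) * d c₃ + ((m : ℤ) - s) * d c₂ := by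
  classical
  have hpt : ∀ b, (d (q b) : ℤ) ≤ (d c₂ : ℤ) + (if q b = c₃ then ((d c₃ : ℤ) - d c₂) else 0) := by
    intro b
    by_cases h3 : q b = c₃
    · rw [if_pos h3, h3]; ring_nf; exact le_refl _
    · rw [if_neg h3, add_zero]
      rcases hcls b with h | h
      · exact absurd h h3
      · exact_mod_cast h
  have hsum := Finset.sum_le_sum fun b (_ : b ∈ (univ : Finset (Fin m))) => hpt b
  rw [Finset.sum_add_distrib, Finset.sum_const, Finset.card_univ, Fintype.card_fin, nsmul_eq_mul, Finset.sum_ite, Finset.sum_const_zero,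
    add_zero, Finset.sum_const, nsmul_eq_mul] at hsum
  have e : (0 : ℤ) ≤ (d c₃ : ℤ) - d c₂ := by have := h23; omega
  have k : ((univ.filter fun b => q b = c₃).card : ℤ) * ((d c₃ : ℤ) - d c₂) ≤ (s : ℤ) * ((d c₃ : ℤ) - d c₂) :=
    mul_le_mul_of_nonneg_right (by exact_mod_cast hs) e
  linarith

/-! ## 3. The shift closure -/

set_option maxHeartbeats 800000 in
/-- **SHIFT CLOSURE.**  `d c₀ < d c₁ < d c₂ < d c₃`; dominant `A ≺ B ≺ C` of the shifted-core shapes with parameter `t` (`A`: classes in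
`{c₂, c₃}` with exactly `t` cells `c₃`; `B`: classes in `{c₁, c₃}` with `t + 1` cells `c₃`; `C`: classes in `{c₀, c₂, c₃}` with `t + 1` cells `c₃` and ONE
cell `c₂`; `t + 2 ≤ m`).  Then no slot transversal through the cells of `A, B, C` other than `A`'s term has at most `t` cells of class `c₃`. [this cell] -/
theorem shift_closure (d : Fin K → ℕ) (v ε : Fin m → Fin m → Fin K → ℤ) (c₀ c₁ c₂ c₃ : Fin K)
    (h01 : d c₀ < d c₁) (h12 : d c₁ < d c₂) (h23 : d c₂ < d c₃) (t : ℕ) (htm : t + 2 ≤ m)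
    {α β γ : Equiv.Perm (Fin m)} {lA lB lC : Fin m → Fin K}
    (hlA : ∀ b, lA b = c₂ ∨ lA b = c₃) (hA3 : (univ.filter fun b => lA b = c₃).card = t)
    (hlB : ∀ b, lB b = c₁ ∨ lB b = c₃) (hB3 : (univ.filter fun b => lB b = c₃).card = t + 1)
    (hlC : ∀ b, lC b = c₀ ∨ lC b = c₂ ∨ lC b = c₃) (hC3 : (univ.filter fun b => lC b = c₃).card = t + 1)
    (hC2 : (univ.filter fun b => lC b = c₂).card = 1)
    {θA θB θC : ℤ} (hAB : θA < θB) (hBC : θB < θC)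
    (hA : IsDominant d v ε θA (α, lA)) (hB : IsDominant d v ε θB (β, lB)) (hC : IsDominant d v ε θC (γ, lC))
    (sM : Fin m → Fin 3) (hMinj : Function.Injective fun b => ((![(α, lA), (β, lB), (γ, lC)] : Fin 3 → _) (sM b)).1 b)
    (hMne : ∃ b, ((![(α, lA), (β, lB), (γ, lC)] : Fin 3 → _) (sM b)).1 b ≠ α b ∨ ((![(α, lA), (β, lB), (γ, lC)] : Fin 3 → _) (sM b)).2 b ≠ lA b)
    (hM3 : (univ.filter fun b => ((![(α, lA), (β, lB), (γ, lC)] : Fin 3 → _) (sM b)).2 b = c₃).card ≤ t) : False := by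
  classical
  have hc23 : c₂ ≠ c₃ := fun h => (ne_of_lt h23) (by rw [h])
  have hc12 : c₁ ≠ c₂ := fun h => (ne_of_lt h12) (by rw [h])
  have hc02 : c₀ ≠ c₂ := fun h => (ne_of_lt (h01.trans h12)) (by rw [h])
  have hc03 : c₀ ≠ c₃ := fun h => (ne_of_lt ((h01.trans h12).trans h23)) (by rw [h])
  set T : Fin 3 → Equiv.Perm (Fin m) × (Fin m → Fin K) := ![(α, lA), (β, lB), (γ, lC)] with hT
  have T0 : T 0 = (α, lA) := rfl
  have T1 : T 1 = (β, lB) := rfl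
  have T2 : T 2 = (γ, lC) := rfl
  set cls : Fin 3 → Fin m → Fin K := fun s b => (T s).2 b with hcls
  have cls0 : (fun b => cls 0 b) = lA := rfl
  have cls1 : (fun b => cls 1 b) = lB := rfl
  have cls2 : (fun b => cls 2 b) = lC := rfl
  -- the three row maps are injective
  have hr : ∀ s : Fin 3, Function.Injective fun b => (T s).1 b := by
    intro s; fin_cases s
    · exact α.injective
    · exact β.injective
    · exact γ.injective
  obtain ⟨s₁, s₂, hs1M, hs2M, hs12, hi₁, hi₂⟩ := two_factor (fun s b => (T s).1 b) hr sM hMinj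
  -- class counts of `A` and `B`
  have hA2 : (univ.filter fun b => lA b = c₂).card = m - t := by
    have hsplit : (univ.filter fun b => lA b = c₂).card + (univ.filter fun b => lA b = c₃).card = m := by
      rw [← Finset.card_union_of_disjoint (Finset.disjoint_filter.mpr fun b _ h2 h3 => hc23 (h2.symm.trans h3))]
      have : (univ.filter fun b => lA b = c₂) ∪ (univ.filter fun b => lA b = c₃) = univ := by
        ext b; simp only [Finset.mem_union, Finset.mem_filter, Finset.mem_univ, true_and, iff_true]; exact hlA b
      rw [this, Finset.card_univ, Fintype.card_fin]
    omega
  have hB2 : (univ.filter fun b => lB b = c₂).card = 0 := by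
    rw [Finset.card_eq_zero, Finset.filter_eq_empty_iff]
    intro b _ h
    rcases hlB b with h' | h'
    · exact hc12 (h'.symm.trans h)
    · exact hc23 (h.symm.trans h')
  -- the totals over the three transversals
  have tot3 := sum_three_card_filter cls sM s₁ s₂ (fun b => (hs1M b).symm) (fun b => (hs2M b).symm) hs12 c₃
  have tot2 := sum_three_card_filter cls sM s₁ s₂ (fun b => (hs1M b).symm) (fun b => (hs2M b).symm) hs12 c₂
  have e03 : (univ.filter fun b => cls 0 b = c₃).card = t := by rw [show (univ.filter fun b => cls 0 b = c₃) = (univ.filter fun b => lA b = c₃) from rfl, hA3]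
  have e13 : (univ.filter fun b => cls 1 b = c₃).card = t + 1 := by rw [show (univ.filter fun b => cls 1 b = c₃) = (univ.filter fun b => lB b = c₃) from rfl, hB3]
  have e23 : (univ.filter fun b => cls 2 b = c₃).card = t + 1 := by rw [show (univ.filter fun b => cls 2 b = c₃) = (univ.filter fun b => lC b = c₃) from rfl, hC3]
  have e02 : (univ.filter fun b => cls 0 b = c₂).card = m - t := by rw [show (univ.filter fun b => cls 0 b = c₂) = (univ.filter fun b => lA b = c₂) from rfl, hA2]
  have e12 : (univ.filter fun b => cls 1 b = c₂).card = 0 := by rw [show (univ.filter fun b => cls 1 b = c₂) = (univ.filter fun b => lB b = c₂) from rfl, hB2]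
  have e22 : (univ.filter fun b => cls 2 b = c₂).card = 1 := by rw [show (univ.filter fun b => cls 2 b = c₂) = (univ.filter fun b => lC b = c₂) from rfl, hC2]
  rw [e03, e13, e23] at tot3
  rw [e02, e12, e22] at tot2
  -- abbreviations for the counts of the three transversals
  set nM3 := (univ.filter fun b => cls (sM b) b = c₃).card with hnM3
  set n13 := (univ.filter fun b => cls (s₁ b) b = c₃).card with hn13
  set n23 := (univ.filter fun b => cls (s₂ b) b = c₃).card with hn23
  set nM2 := (univ.filter fun b => cls (sM b) b = c₂).card with hnM2
  set n12 := (univ.filter fun b => cls (s₁ b) b = c₂).card with hn12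
  set n22 := (univ.filter fun b => cls (s₂ b) b = c₂).card with hn22
  have hM3' : nM3 ≤ t := hM3
  -- `M` has at most `m − nM3` cells of class `c₂`
  have hM2le : nM3 + nM2 ≤ m := by
    rw [hnM2, hnM3, ← Finset.card_union_of_disjoint (Finset.disjoint_filter.mpr fun b _ h3 h2 => hc23 (h2.symm.trans h3))]
    exact le_trans (Finset.card_le_univ _) (by rw [Fintype.card_fin])
  -- classes present: all of exponent `≥ d c₀`; top or `≤ d c₂`
  have hlow : ∀ (s : Fin 3) (b : Fin m), d c₀ ≤ d (cls s b) := by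
    intro s b
    fin_cases s
    · show d c₀ ≤ d (lA b); rcases hlA b with h | h <;> rw [h] <;> omega
    · show d c₀ ≤ d (lB b); rcases hlB b with h | h <;> rw [h] <;> omega
    · show d c₀ ≤ d (lC b); rcases hlC b with h | h | h <;> rw [h] <;> omega
  have hcls3 : ∀ (s : Fin 3) (b : Fin m), cls s b = c₃ ∨ d (cls s b) ≤ d c₂ := by
    intro s b
    fin_cases s
    · show lA b = c₃ ∨ d (lA b) ≤ d c₂
      rcases hlA b with h | h
      · exact Or.inr (by rw [h])
      · exact Or.inl h
    · show lB b = c₃ ∨ d (lB b) ≤ d c₂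
      rcases hlB b with h | h
      · exact Or.inr (by rw [h]; exact h12.le)
      · exact Or.inl h
    · show lC b = c₃ ∨ d (lC b) ≤ d c₂
      rcases hlC b with h | h | h
      · exact Or.inr (by rw [h]; exact (h01.trans h12).le)
      · exact Or.inr (by rw [h])
      · exact Or.inl h
  -- the slopes of `A` and `C`
  have hSA : (t : ℤ) * d c₃ + ((m : ℤ) - t) * d c₂ ≤ ∑ b, (d (lA b) : ℤ) := by
    have h := le_sum_of_card_filter d lA c₀ c₂ c₃ (h01.trans h12).le ((h01.trans h12).trans h23).le hc23 (fun b => hlow 0 b)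
      t (m - t) (by rw [hA3]) (by rw [hA2])
    have e' : (((m - t : ℕ) : ℤ)) = (m : ℤ) - t := by push_cast [Nat.cast_sub (by omega : t ≤ m)]; ring
    rw [e'] at h
    nlinarith [h]
  have hSC : ∑ b, (d (lC b) : ℤ) = ((t : ℤ) + 1) * d c₃ + d c₂ + ((m : ℤ) - t - 2) * d c₀ := by
    have hpt : ∀ b, (d (lC b) : ℤ) = (d c₀ : ℤ) + ((if lC b = c₃ then ((d c₃ : ℤ) - d c₀) else 0) + (if lC b = c₂ then ((d c₂ : ℤ) - d c₀) else 0)) := by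
      intro b
      rcases hlC b with h | h | h
      · rw [h, if_neg hc03, if_neg hc02]; ring
      · rw [h, if_neg hc23, if_pos rfl]; ring
      · rw [h, if_pos rfl, if_neg (fun e => hc23 e.symm)]; ring
    rw [Finset.sum_congr rfl fun b _ => hpt b, Finset.sum_add_distrib, Finset.sum_add_distrib, Finset.sum_const, Finset.card_univ,
      Fintype.card_fin, nsmul_eq_mul]
    rw [Finset.sum_ite, Finset.sum_const_zero, add_zero, Finset.sum_const, nsmul_eq_mul]
    rw [Finset.sum_ite, Finset.sum_const_zero, add_zero, Finset.sum_const, nsmul_eq_mul, hC3, hC2]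
    push_cast
    ring
  -- `P₁`: `S(M) ≤ S(A)`
  have hP1 : ∑ b, (d ((T (sM b)).2 b) : ℤ) ≤ ∑ b, (d ((T 0).2 b) : ℤ) := by
    have h := sum_le_of_card_filter d (fun b => cls (sM b) b) c₂ c₃ h23.le (fun b => hcls3 (sM b) b) t hM3'
    have h23' : (d c₂ : ℤ) ≤ d c₃ := by exact_mod_cast h23.le
    show ∑ b, (d (cls (sM b) b) : ℤ) ≤ ∑ b, (d (lA b) : ℤ)
    linarith [hSA, h]
  -- `P₂` for a transversal with `≥ t + 2` top cells, or `≥ t + 1` top cells and a `c₂` cell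
  have hP2_of : ∀ q : Fin m → Fin 3, (t + 2 ≤ (univ.filter fun b => cls (q b) b = c₃).card ∨
      (t + 1 ≤ (univ.filter fun b => cls (q b) b = c₃).card ∧ 1 ≤ (univ.filter fun b => cls (q b) b = c₂).card)) →
      ∑ b, (d ((T 2).2 b) : ℤ) ≤ ∑ b, (d ((T (q b)).2 b) : ℤ) := by
    intro q hq
    show ∑ b, (d (lC b) : ℤ) ≤ ∑ b, (d (cls (q b) b) : ℤ)
    rw [hSC]
    have h23' : (d c₂ : ℤ) ≤ d c₃ := by exact_mod_cast h23.le
    have h02' : (d c₀ : ℤ) ≤ d c₂ := by exact_mod_cast (h01.trans h12).le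
    rcases hq with hq | ⟨hq3, hq2⟩
    · have h := le_sum_of_card_filter d (fun b => cls (q b) b) c₀ c₂ c₃ (h01.trans h12).le ((h01.trans h12).trans h23).le hc23
        (fun b => hlow (q b) b) (t + 2) 0 hq (Nat.zero_le _)
      have e1 : (((t + 2 : ℕ)) : ℤ) = (t : ℤ) + 2 := by norm_cast
      have e2 : (((0 : ℕ)) : ℤ) = (0 : ℤ) := by norm_cast
      rw [e1, e2] at h
      linarith [h, h23', h02']
    · have h := le_sum_of_card_filter d (fun b => cls (q b) b) c₀ c₂ c₃ (h01.trans h12).le ((h01.trans h12).trans h23).le hc23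
        (fun b => hlow (q b) b) (t + 1) 1 hq3 hq2
      have e1 : (((t + 1 : ℕ)) : ℤ) = (t : ℤ) + 1 := by norm_cast
      have e2 : (((1 : ℕ)) : ℤ) = (1 : ℤ) := by norm_cast
      rw [e1, e2] at h
      linarith [h, h23', h02']
  -- dominance data for `latin_contra_sum`
  set θ3 : Fin 3 → ℤ := ![θA, θB, θC] with hθ3
  have hdomT : ∀ k, IsDominant d v ε (θ3 k) (T k) := by
    intro k; fin_cases k
    · exact hA
    · exact hB
    · exact hC
  have hneM : ∃ b, (T (sM b)).1 b ≠ (T 0).1 b ∨ (T (sM b)).2 b ≠ (T 0).2 b := by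
    obtain ⟨b, hb⟩ := hMne; exact ⟨b, hb⟩
  -- which transversal is rich in top cells?
  by_cases h1 : t + 2 ≤ n13
  · exact latin_contra_sum d v ε T θ3 hAB hBC hdomT sM s₂ s₁ (fun b => (hs2M b).symm) (fun b => (hs1M b).symm)
      (fun b => (hs12 b).symm) hMinj hi₂ hi₁ hneM hP1 (hP2_of s₁ (Or.inl h1))
  by_cases h2 : t + 2 ≤ n23
  · exact latin_contra_sum d v ε T θ3 hAB hBC hdomT sM s₁ s₂ (fun b => (hs1M b).symm) (fun b => (hs2M b).symm)
      hs12 hMinj hi₁ hi₂ hneM hP1 (hP2_of s₂ (Or.inl h2))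
  -- both have exactly `t + 1` top cells and `M` exactly `t`; a `c₂` cell is left over for one of them
  have h2left : 1 ≤ n12 ∨ 1 ≤ n22 := by omega
  rcases h2left with h | h
  · exact latin_contra_sum d v ε T θ3 hAB hBC hdomT sM s₂ s₁ (fun b => (hs2M b).symm) (fun b => (hs1M b).symm)
      (fun b => (hs12 b).symm) hMinj hi₂ hi₁ hneM hP1 (hP2_of s₁ (Or.inr ⟨by omega, h⟩))
  · exact latin_contra_sum d v ε T θ3 hAB hBC hdomT sM s₁ s₂ (fun b => (hs1M b).symm) (fun b => (hs2M b).symm)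
      hs12 hMinj hi₁ hi₂ hneM hP1 (hP2_of s₂ (Or.inr ⟨by omega, h⟩))

end LexCore

end Summit.ValiantsHypothesis.ValiantsHypothesis.Theorems.KPlusLogSqLaw
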